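import Summits.QuantumFields.YangMills.Theorems.SourcedPressureJensenSourcedPressureIncrementGaussWickCovariance
import Summits.QuantumFields.YangMills.Theorems.SourcedPressureJensenSourcedPressureIncrementCurvatureDecay
import Literature.Barriers.CriticalPhenomena.LaceExpansionXSpaceAsymptotics
import HarnessLib

/-!
# `SourcedPressureIncrement` (stmt-QuantumFields-22517), line `birth`: the SECOND `h`-CUMULANT of the Gaussian sourced increment
# is extensive — uniform susceptibility bound `Σ_y |Cov_γ(X_x, X_y)| ≤ M₂`, `Var_γ(H_B) ≤ M₂|B|` (file 3/3; `stub_gauss` at order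
# `h²`, the `β → ∞` value of the tilted susceptibility `M` of the cold-box item stmt-QuantumFields-23807)

Continues `…GaussWickCovariance` (file 2/3), whose `abs_gauss_cov_le` bounds the covariance of two site terms
`X_x = A_xA_{x+ne₀}` of the source `H_B = Σ_{x∈B} X_x` of `gaussIncrement` (the ideator's BC3 skeleton
`bc/SourcedPressureIncrement_birth.lean`, stub `stub_gauss`: `gaussIncrement ≤ −h(λ²D/2)C(n)² + M h² + C n/L`) by the form `Φ(x, y, n)`
in the `(1,2)`-plaquette two-point numbers.  Here, in `d = 4`:

* `exists_abs_curvatureTwoPoint_plaquette12_le` — `|C(p₁₂x, p₁₂y)| ≤ K(1 + |x − y|)^{−4}` (tree `CurvatureDecay`,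
  `exists_abs_curvatureTwoPoint_parallel_le_one_add`); `summable_one_add_euclidNorm_rpow_neg_eight` — `Σ_{z∈ℤ⁴}(1+|z|)^{−8} < ∞`
  (tree lattice `p`-series `summable_jnorm_rpow_neg`); `covForm_decay_le` — `Φ` at the decay majorants is
  `≤ K⁴(36g(x−y)² + 10g(x−ne₀−y)² + 10g(x+ne₀−y)²)`, `g = (1+|·|)^{−4}`, uniformly in `n` (`|C(n)| ≤ K`);
* **`exists_sum_abs_gauss_cov_le`** — there is `M₂ = M₂(D, λ)` with `Σ_{y∈B} |E_γ[(X_x − EX_x)(X_y − EX_y)]| ≤ M₂` for EVERY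
  separation `n`, site `x` and finite `B ⊂ ℤ⁴` (two propagators between `{x, x'}` and `{y, y'}` in every term, each
  `O((1+dist)^{−4})`, square-summable in four dimensions);
* **`gauss_secondCumulant_le`** / `gauss_variance_le` — `Var_γ(H_B) = E_γ[(H_B − |B|(λ²D/2)C(n)²)²] ≤ M₂·|B|` for every `n` and
  finite `B` (the source written VERBATIM as in `gaussIncrement`; mean from `gauss_firstCumulant_sum`): the coefficient of `h²/2`
  of `log E_γ e^{−hH_B}` is extensive, uniformly in the box and the separation — item (2) of the `stub_gauss` anatomy
  (evidence note on stmt-QuantumFields-22517, 2026-08-27).  What this does NOT give: orders `≥ 3` in `h` / the tilted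
  (`h̃ > 0`) susceptibility, which need decay of correlations under the perturbed measure.

Imports Literature and this line's helper files only (no route file).  RECORD-label rung support (all-`G` leaf
`WeakCouplingRates.XiPow`); the Yang–Mills mass gap is NOT proved by anything here.  Sources: S. Janson, *Gaussian Hilbert Spaces*
(1997) Thm 1.28; G. Lawler, *Intersections of random walks* (1991) Thm 1.5.5 (via `CurvatureDecay`). [folklore]
-/

noncomputable section

open MeasureTheory ProbabilityTheory
open Literature.Probability.Distributions

namespace Summit.QuantumFields.YangMills.Cruxes.SourcedPressureIncrement.Birth

/-! ### §4 Summable decay in `d = 4`: the uniform susceptibility bound and the variance of the source -/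

section Susceptibility

open Literature.MathematicalPhysics.QuantumFieldTheory Literature.MathematicalPhysics.QuantumLattice
open Literature.Probability.LatticeModels Literature.Barriers.CriticalPhenomena

/-- The covariance form evaluated at the decay majorants `K·a, K·a, K·b, K·c, K, K` (`a, b, c ∈ [0, 1]`) is at most
`K⁴(36a² + 10b² + 10c²)` (`a⁴ ≤ a²`, `b²c² ≤ bc ≤ (b² + c²)/2`, `a²bc ≤ a²`). [folklore] -/
theorem covForm_decay_le {K a b c : ℝ} (ha0 : 0 ≤ a) (ha1 : a ≤ 1) (hb0 : 0 ≤ b) (hb1 : b ≤ 1)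
    (hc0 : 0 ≤ c) (hc1 : c ≤ 1) :
    4 * ((K * a) ^ 2 * (K * a) ^ 2) + 4 * ((K * b) ^ 2 * (K * c) ^ 2) + 16 * ((K * a) * (K * b) * (K * c) * (K * a)) +
        16 * (K * K) * ((K * a) * (K * a) + (K * b) * (K * c)) ≤
      K ^ 4 * (36 * a ^ 2 + 10 * b ^ 2 + 10 * c ^ 2) := by
  have hK4 : 0 ≤ K ^ 4 := by positivity
  have e : 4 * ((K * a) ^ 2 * (K * a) ^ 2) + 4 * ((K * b) ^ 2 * (K * c) ^ 2) + 16 * ((K * a) * (K * b) * (K * c) * (K * a)) +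
        16 * (K * K) * ((K * a) * (K * a) + (K * b) * (K * c)) =
      K ^ 4 * (4 * (a ^ 2 * a ^ 2) + 4 * ((b * c) * (b * c)) + 16 * (a ^ 2 * (b * c)) + 16 * a ^ 2 + 16 * (b * c)) := by
    ring
  rw [e]
  refine mul_le_mul_of_nonneg_left ?_ hK4
  have ha2 : a ^ 2 ≤ 1 := pow_le_one₀ ha0 ha1
  have hbc0 : 0 ≤ b * c := mul_nonneg hb0 hc0
  have hbc1 : b * c ≤ 1 := mul_le_one₀ hb1 hc0 hc1
  have h1 : a ^ 2 * a ^ 2 ≤ a ^ 2 := by nlinarith [sq_nonneg a]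
  have h2 : (b * c) * (b * c) ≤ b * c := by nlinarith
  have h3 : b * c ≤ (b ^ 2 + c ^ 2) / 2 := by nlinarith [sq_nonneg (b - c)]
  have h4 : a ^ 2 * (b * c) ≤ a ^ 2 := by nlinarith [sq_nonneg a]
  linarith

/-- **Decay of the `(1,2)`-plaquette two-point function in `d = 4`** (tree `exists_abs_curvatureTwoPoint_parallel_le_one_add`):
`|curvatureTwoPoint (p₁₂ x) (p₁₂ y)| ≤ K (1 + |x − y|)^{−4}`, `|·|` Euclidean. [folklore] -/
theorem exists_abs_curvatureTwoPoint_plaquette12_le :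
    ∃ K : ℝ, 0 ≤ K ∧ ∀ x y : Site 4,
      |curvatureTwoPoint (plaquette12 (d := 4) (by norm_num) x) (plaquette12 (d := 4) (by norm_num) y)| ≤
        K * (1 + euclidNorm (x - y)) ^ (-(4 : ℝ)) := by
  obtain ⟨C, hC0, hC⟩ := exists_abs_curvatureTwoPoint_parallel_le_one_add (d := 4) (by norm_num)
  refine ⟨C, hC0, fun x y => ?_⟩
  have h := hC x y ⟨(⟨1, by omega⟩, ⟨2, by omega⟩), Fin.mk_lt_mk.2 one_lt_two⟩
  have e : ((4 : ℕ) : ℝ) = 4 := by norm_num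
  rw [e] at h
  exact h

/-- The squared decay profile `(1 + |z|)^{−8}` is summable over `ℤ⁴` (`8 > 4`; the tree's lattice `p`-series
`summable_jnorm_rpow_neg`, `⟦z⟧ = max(|z|, 1) ≤ 1 + |z|`). [folklore] -/
theorem summable_one_add_euclidNorm_rpow_neg_eight :
    Summable fun z : Site 4 => (1 + euclidNorm z) ^ (-(8 : ℝ)) := by
  have hj := summable_jnorm_rpow_neg (d := 4) (s := 8) (by norm_num)
  refine Summable.of_nonneg_of_le (fun z => Real.rpow_nonneg (by linarith [euclidNorm_nonneg z]) _) (fun z => ?_) hj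
  have hle : jnorm z ≤ 1 + euclidNorm z := max_le (by linarith) (by linarith [euclidNorm_nonneg z])
  exact Real.rpow_le_rpow_of_nonpos (jnorm_pos z) hle (by norm_num)

/-- **UNIFORM SUSCEPTIBILITY BOUND (the `M` of `stub_gauss` at order `h²`).**  There is `M₂ = M₂(D, λ)` such that for
every separation `n`, every site `x` and every finite `B ⊂ ℤ⁴`:
`Σ_{y ∈ B} |E_γ[(X_x − E X_x)(X_y − E X_y)]| ≤ M₂`, `X_x = A_x A_{x + n e₀}` the summand of `gaussIncrement`,
`E X_x = (λ²D/2) C(n)²` — every term of the Wick-square covariance carries two propagators between `{x, x + n e₀}` and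
`{y, y + n e₀}`, each `O((1 + dist)^{−4})` (`CurvatureDecay`), and `Σ_z (1 + |z|)^{−8} < ∞` in four dimensions; uniformly in
`n` because `|C(n)| ≤ K`. [cite: Janson1997, Thm 1.28] -/
theorem exists_sum_abs_gauss_cov_le (D : ℕ) (lam : ℝ) : ∃ M₂ : ℝ, 0 ≤ M₂ ∧
    ∀ (n : ℕ) (x : Site 4) (B : Finset (Site 4)),
      ∑ y ∈ B, |∫ Y, ((lam / 2 * (∑ a : Fin D, (Y (plaquette12 (d := 4) (by norm_num) x) a) ^ 2) -
              lam / 2 * D * curvaturePlaquetteCorr (d := 4) (by norm_num) 0) *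
            (lam / 2 * (∑ a : Fin D, (Y (plaquette12 (d := 4) (by norm_num) (x + Pi.single (0 : Fin 4) (n : ℤ))) a) ^ 2) -
              lam / 2 * D * curvaturePlaquetteCorr (d := 4) (by norm_num) 0) -
            lam ^ 2 * D / 2 * (curvaturePlaquetteCorr (d := 4) (by norm_num) (n : ℤ)) ^ 2) *
          ((lam / 2 * (∑ a : Fin D, (Y (plaquette12 (d := 4) (by norm_num) y) a) ^ 2) -
              lam / 2 * D * curvaturePlaquetteCorr (d := 4) (by norm_num) 0) *
            (lam / 2 * (∑ a : Fin D, (Y (plaquette12 (d := 4) (by norm_num) (y + Pi.single (0 : Fin 4) (n : ℤ))) a) ^ 2) -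
              lam / 2 * D * curvaturePlaquetteCorr (d := 4) (by norm_num) 0) -
            lam ^ 2 * D / 2 * (curvaturePlaquetteCorr (d := 4) (by norm_num) (n : ℤ)) ^ 2)
        ∂curvatureGaussianField (d := 4) D| ≤ M₂ := by
  obtain ⟨K, hK0, hK⟩ := exists_abs_curvatureTwoPoint_plaquette12_le
  set g2 : Site 4 → ℝ := fun z => (1 + euclidNorm z) ^ (-(8 : ℝ)) with hg2
  have hg2nn : ∀ z, 0 ≤ g2 z := fun z => Real.rpow_nonneg (by linarith [euclidNorm_nonneg z]) _
  have hg2s : Summable g2 := summable_one_add_euclidNorm_rpow_neg_eight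
  set G : ℝ := ∑' z, g2 z with hG
  have hG0 : 0 ≤ G := tsum_nonneg hg2nn
  refine ⟨(lam / 2) ^ 4 * (D : ℝ) ^ 4 * (K ^ 4 * (56 * G)), by positivity, fun n x B => ?_⟩
  set v : Site 4 := Pi.single (0 : Fin 4) (n : ℤ) with hv
  -- translated partial sums of the profile are bounded by the full sum
  have hshift : ∀ w : Site 4, ∑ y ∈ B, g2 (w - y) ≤ G := by
    intro w
    have e : ∑ y ∈ B, g2 (w - y) = ∑ z ∈ B.map (Equiv.subLeft w).toEmbedding, g2 z := by
      rw [Finset.sum_map]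
      rfl
    rw [e]
    exact hg2s.sum_le_tsum _ (fun z _ => hg2nn z)
  -- the decay profile `g(z) = (1 + |z|)^{-4}` and its square
  have hg : ∀ z : Site 4, 0 ≤ (1 + euclidNorm z) ^ (-(4 : ℝ)) ∧ (1 + euclidNorm z) ^ (-(4 : ℝ)) ≤ 1 ∧
      ((1 + euclidNorm z) ^ (-(4 : ℝ))) ^ 2 = g2 z := by
    intro z
    have h1 : 1 ≤ 1 + euclidNorm z := by linarith [euclidNorm_nonneg z]
    refine ⟨Real.rpow_nonneg (by linarith) _, Real.rpow_le_one_of_one_le_of_nonpos h1 (by norm_num), ?_⟩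
    rw [hg2]
    dsimp only
    rw [← Real.rpow_natCast, ← Real.rpow_mul (by linarith)]
    norm_num
  -- per-site bound by the profile
  have hy : ∀ y : Site 4,
      |∫ Y, ((lam / 2 * (∑ a : Fin D, (Y (plaquette12 (d := 4) (by norm_num) x) a) ^ 2) -
              lam / 2 * D * curvaturePlaquetteCorr (d := 4) (by norm_num) 0) *
            (lam / 2 * (∑ a : Fin D, (Y (plaquette12 (d := 4) (by norm_num) (x + v)) a) ^ 2) -
              lam / 2 * D * curvaturePlaquetteCorr (d := 4) (by norm_num) 0) -
            lam ^ 2 * D / 2 * (curvaturePlaquetteCorr (d := 4) (by norm_num) (n : ℤ)) ^ 2) *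
          ((lam / 2 * (∑ a : Fin D, (Y (plaquette12 (d := 4) (by norm_num) y) a) ^ 2) -
              lam / 2 * D * curvaturePlaquetteCorr (d := 4) (by norm_num) 0) *
            (lam / 2 * (∑ a : Fin D, (Y (plaquette12 (d := 4) (by norm_num) (y + v)) a) ^ 2) -
              lam / 2 * D * curvaturePlaquetteCorr (d := 4) (by norm_num) 0) -
            lam ^ 2 * D / 2 * (curvaturePlaquetteCorr (d := 4) (by norm_num) (n : ℤ)) ^ 2)
        ∂curvatureGaussianField (d := 4) D| ≤
      (lam / 2) ^ 4 * (D : ℝ) ^ 4 * (K ^ 4 * (36 * g2 (x - y) + 10 * g2 (x - v - y) + 10 * g2 (x + v - y))) := by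
    intro y
    refine (abs_gauss_cov_le D lam n x y).trans (mul_le_mul_of_nonneg_left ?_ (by positivity))
    obtain ⟨ha0, ha1, ha2⟩ := hg (x - y)
    obtain ⟨hb0, hb1, hb2⟩ := hg (x - v - y)
    obtain ⟨hc0, hc1, hc2⟩ := hg (x + v - y)
    -- the six two-point bounds
    have h13 := hK x y
    have h24 : |curvatureTwoPoint (plaquette12 (d := 4) (by norm_num) (x + v)) (plaquette12 (d := 4) (by norm_num) (y + v))|
        ≤ K * (1 + euclidNorm (x - y)) ^ (-(4 : ℝ)) := by
      have h := hK (x + v) (y + v); rwa [add_sub_add_right_eq_sub] at h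
    have h14 : |curvatureTwoPoint (plaquette12 (d := 4) (by norm_num) x) (plaquette12 (d := 4) (by norm_num) (y + v))|
        ≤ K * (1 + euclidNorm (x - v - y)) ^ (-(4 : ℝ)) := by
      have h := hK x (y + v); rwa [show x - (y + v) = x - v - y by abel] at h
    have h23 : |curvatureTwoPoint (plaquette12 (d := 4) (by norm_num) (x + v)) (plaquette12 (d := 4) (by norm_num) y)|
        ≤ K * (1 + euclidNorm (x + v - y)) ^ (-(4 : ℝ)) := hK (x + v) y
    have h12 : |curvatureTwoPoint (plaquette12 (d := 4) (by norm_num) x) (plaquette12 (d := 4) (by norm_num) (x + v))|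
        ≤ K := by
      refine (hK x (x + v)).trans ?_
      exact mul_le_of_le_one_right hK0 (hg _).2.1
    have h34 : |curvatureTwoPoint (plaquette12 (d := 4) (by norm_num) y) (plaquette12 (d := 4) (by norm_num) (y + v))|
        ≤ K := by
      refine (hK y (y + v)).trans ?_
      exact mul_le_of_le_one_right hK0 (hg _).2.1
    refine (covForm_mono (abs_nonneg _) h12 (abs_nonneg _) h13 (abs_nonneg _) h14 (abs_nonneg _) h23
      (abs_nonneg _) h24 (abs_nonneg _) h34).trans ?_
    rw [← ha2, ← hb2, ← hc2]
    exact covForm_decay_le ha0 ha1 hb0 hb1 hc0 hc1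
  -- sum over `y ∈ B`
  have hsum : ∑ y ∈ B, (36 * g2 (x - y) + 10 * g2 (x - v - y) + 10 * g2 (x + v - y)) ≤ 56 * G := by
    rw [Finset.sum_add_distrib, Finset.sum_add_distrib, ← Finset.mul_sum, ← Finset.mul_sum, ← Finset.mul_sum]
    linarith [hshift x, hshift (x - v), hshift (x + v)]
  calc _ ≤ ∑ y ∈ B, (lam / 2) ^ 4 * (D : ℝ) ^ 4 * (K ^ 4 * (36 * g2 (x - y) + 10 * g2 (x - v - y) + 10 * g2 (x + v - y))) :=
        Finset.sum_le_sum fun y _ => hy y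
    _ = (lam / 2) ^ 4 * (D : ℝ) ^ 4 * (K ^ 4 * ∑ y ∈ B, (36 * g2 (x - y) + 10 * g2 (x - v - y) + 10 * g2 (x + v - y))) := by
        rw [Finset.mul_sum, Finset.mul_sum]
    _ ≤ (lam / 2) ^ 4 * (D : ℝ) ^ 4 * (K ^ 4 * (56 * G)) := by gcongr

/-- Integrability of the centred product of two site terms of the Gaussian source (a polynomial in finitely many plaquette
variables). [cite: Janson1997, Ch. 1 §3, sentence before Thm 1.28] -/
theorem integrable_gauss_centred_mul (D : ℕ) (lam : ℝ) (n : ℕ) (x y : Site 4) :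
    Integrable (fun Y : ZdPlaquette 4 → Fin D → ℝ =>
      ((lam / 2 * (∑ a : Fin D, (Y (plaquette12 (d := 4) (by norm_num) x) a) ^ 2) -
              lam / 2 * D * curvaturePlaquetteCorr (d := 4) (by norm_num) 0) *
            (lam / 2 * (∑ a : Fin D, (Y (plaquette12 (d := 4) (by norm_num) (x + Pi.single (0 : Fin 4) (n : ℤ))) a) ^ 2) -
              lam / 2 * D * curvaturePlaquetteCorr (d := 4) (by norm_num) 0) -
            lam ^ 2 * D / 2 * (curvaturePlaquetteCorr (d := 4) (by norm_num) (n : ℤ)) ^ 2) *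
          ((lam / 2 * (∑ a : Fin D, (Y (plaquette12 (d := 4) (by norm_num) y) a) ^ 2) -
              lam / 2 * D * curvaturePlaquetteCorr (d := 4) (by norm_num) 0) *
            (lam / 2 * (∑ a : Fin D, (Y (plaquette12 (d := 4) (by norm_num) (y + Pi.single (0 : Fin 4) (n : ℤ))) a) ^ 2) -
              lam / 2 * D * curvaturePlaquetteCorr (d := 4) (by norm_num) 0) -
            lam ^ 2 * D / 2 * (curvaturePlaquetteCorr (d := 4) (by norm_num) (n : ℤ)) ^ 2))
      (curvatureGaussianField (d := 4) D) := by
  have hd : 3 ≤ 4 := by norm_num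
  have hX := isGaussianProcess_eval_curvatureGaussianField (d := 4) hd D
  set v : Site 4 := Pi.single (0 : Fin 4) (n : ℤ) with hv
  set C0 : ℝ := curvaturePlaquetteCorr (d := 4) hd 0 with hC0
  set m : ℝ := lam ^ 2 * D / 2 * (curvaturePlaquetteCorr (d := 4) hd (n : ℤ)) ^ 2 with hm
  -- the site term as a polynomial in the plaquette variables
  set q : Site 4 → MvPolynomial (ZdPlaquette 4 × Fin D) ℝ := fun z =>
    (MvPolynomial.C (lam / 2) * (∑ a : Fin D, MvPolynomial.X (plaquette12 (d := 4) hd z, a) ^ 2) -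
        MvPolynomial.C (lam / 2 * D * C0)) *
      (MvPolynomial.C (lam / 2) * (∑ a : Fin D, MvPolynomial.X (plaquette12 (d := 4) hd (z + v), a) ^ 2) -
        MvPolynomial.C (lam / 2 * D * C0)) - MvPolynomial.C m with hq
  refine (integrable_mvPolynomial_eval hX id (q x * q y)).congr (ae_of_all _ fun Y => ?_)
  simp [hq, map_sum]

/-- **THE SECOND CUMULANT OF THE GAUSSIAN SOURCE IS EXTENSIVE**: there is `M₂ = M₂(D, λ)` with
`Var_γ(H_B) = E_γ[(H_B − |B|·(λ²D/2)C(n)²)²] ≤ M₂ · |B|` for every separation `n` and every finite `B ⊂ ℤ⁴`, where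
`H_B = Σ_{x ∈ B} A_x A_{x + n e₀}` is the source of `gaussIncrement` (verbatim; its mean is `|B|·(λ²D/2)C(n)²` by
`gauss_firstCumulant_sum`).  This is the coefficient of `h²/2` in the `h`-expansion of `log E_γ e^{−h H_B}`: the `M h²` term of
`stub_gauss` at second order, uniform in the box and the separation. [cite: Janson1997, Thm 1.28] -/
theorem gauss_secondCumulant_le (D : ℕ) (lam : ℝ) : ∃ M₂ : ℝ, 0 ≤ M₂ ∧ ∀ (n : ℕ) (B : Finset (Site 4)),
    ∫ Y, (∑ x ∈ B,
            (lam / 2 * (∑ a : Fin D, (Y (plaquette12 (d := 4) (by norm_num) x) a) ^ 2) -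
                lam / 2 * D * curvaturePlaquetteCorr (d := 4) (by norm_num) 0) *
              (lam / 2 * (∑ a : Fin D, (Y (plaquette12 (d := 4) (by norm_num) (x + Pi.single (0 : Fin 4) (n : ℤ))) a) ^ 2) -
                lam / 2 * D * curvaturePlaquetteCorr (d := 4) (by norm_num) 0) -
          (B.card : ℝ) * (lam ^ 2 * D / 2 * (curvaturePlaquetteCorr (d := 4) (by norm_num) (n : ℤ)) ^ 2)) ^ 2
      ∂curvatureGaussianField (d := 4) D ≤ M₂ * B.card := by
  obtain ⟨M₂, hM0, hM⟩ := exists_sum_abs_gauss_cov_le D lam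
  refine ⟨M₂, hM0, fun n B => ?_⟩
  have hd : 3 ≤ 4 := by norm_num
  set γ := curvatureGaussianField (d := 4) D with hγ
  set v : Site 4 := Pi.single (0 : Fin 4) (n : ℤ) with hv
  set C0 : ℝ := curvaturePlaquetteCorr (d := 4) hd 0 with hC0
  set m : ℝ := lam ^ 2 * D / 2 * (curvaturePlaquetteCorr (d := 4) hd (n : ℤ)) ^ 2 with hm
  set c : Site 4 → (ZdPlaquette 4 → Fin D → ℝ) → ℝ := fun z Y =>
    (lam / 2 * (∑ a : Fin D, (Y (plaquette12 (d := 4) hd z) a) ^ 2) - lam / 2 * D * C0) *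
        (lam / 2 * (∑ a : Fin D, (Y (plaquette12 (d := 4) hd (z + v)) a) ^ 2) - lam / 2 * D * C0) - m with hc
  have hsumM : ∀ z : Site 4, ∑ w ∈ B, |∫ Y, c z Y * c w Y ∂γ| ≤ M₂ := fun z => hM n z B
  have icc : ∀ z w : Site 4, Integrable (fun Y => c z Y * c w Y) γ := fun z w => integrable_gauss_centred_mul D lam n z w
  -- centre termwise and expand the square over `B ×ˢ B`
  have e1 : ∀ Y : ZdPlaquette 4 → Fin D → ℝ,
      (∑ x ∈ B, (lam / 2 * (∑ a : Fin D, (Y (plaquette12 (d := 4) hd x) a) ^ 2) - lam / 2 * D * C0) *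
            (lam / 2 * (∑ a : Fin D, (Y (plaquette12 (d := 4) hd (x + v)) a) ^ 2) - lam / 2 * D * C0) -
          (B.card : ℝ) * m) ^ 2 =
        ∑ xy ∈ B ×ˢ B, c xy.1 Y * c xy.2 Y := by
    intro Y
    have h1 : ∑ x ∈ B, (lam / 2 * (∑ a : Fin D, (Y (plaquette12 (d := 4) hd x) a) ^ 2) - lam / 2 * D * C0) *
            (lam / 2 * (∑ a : Fin D, (Y (plaquette12 (d := 4) hd (x + v)) a) ^ 2) - lam / 2 * D * C0) -
          (B.card : ℝ) * m = ∑ x ∈ B, c x Y := by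
      simp only [hc, Finset.sum_sub_distrib, Finset.sum_const, nsmul_eq_mul]
    rw [h1, sq, Finset.sum_mul_sum, ← Finset.sum_product']
  calc ∫ Y, (∑ x ∈ B, (lam / 2 * (∑ a : Fin D, (Y (plaquette12 (d := 4) hd x) a) ^ 2) - lam / 2 * D * C0) *
            (lam / 2 * (∑ a : Fin D, (Y (plaquette12 (d := 4) hd (x + v)) a) ^ 2) - lam / 2 * D * C0) -
          (B.card : ℝ) * m) ^ 2 ∂γ
      = ∑ xy ∈ B ×ˢ B, ∫ Y, c xy.1 Y * c xy.2 Y ∂γ := by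
        rw [integral_congr_ae (ae_of_all _ e1), integral_finsetSum _ (fun xy _ => icc xy.1 xy.2)]
    _ ≤ ∑ xy ∈ B ×ˢ B, |∫ Y, c xy.1 Y * c xy.2 Y ∂γ| := Finset.sum_le_sum fun xy _ => le_abs_self _
    _ = ∑ x ∈ B, ∑ y ∈ B, |∫ Y, c x Y * c y Y ∂γ| := Finset.sum_product _ _ _
    _ ≤ ∑ _x ∈ B, M₂ := Finset.sum_le_sum fun x _ => hsumM x
    _ = M₂ * B.card := by rw [Finset.sum_const, nsmul_eq_mul, mul_comm]

/-- **VARIANCE FORM**: `E_γ[(H_B − E_γ H_B)²] ≤ M₂ · |B|` for every separation `n` and finite `B ⊂ ℤ⁴` (the mean inserted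
from `gauss_firstCumulant_sum`). [cite: Janson1997, Thm 1.28] -/
theorem gauss_variance_le (D : ℕ) (lam : ℝ) : ∃ M₂ : ℝ, 0 ≤ M₂ ∧ ∀ (n : ℕ) (B : Finset (Site 4)),
    ∫ Y, (∑ x ∈ B,
            (lam / 2 * (∑ a : Fin D, (Y (plaquette12 (d := 4) (by norm_num) x) a) ^ 2) -
                lam / 2 * D * curvaturePlaquetteCorr (d := 4) (by norm_num) 0) *
              (lam / 2 * (∑ a : Fin D, (Y (plaquette12 (d := 4) (by norm_num) (x + Pi.single (0 : Fin 4) (n : ℤ))) a) ^ 2) -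
                lam / 2 * D * curvaturePlaquetteCorr (d := 4) (by norm_num) 0) -
          ∫ Y', ∑ x ∈ B,
            (lam / 2 * (∑ a : Fin D, (Y' (plaquette12 (d := 4) (by norm_num) x) a) ^ 2) -
                lam / 2 * D * curvaturePlaquetteCorr (d := 4) (by norm_num) 0) *
              (lam / 2 * (∑ a : Fin D, (Y' (plaquette12 (d := 4) (by norm_num) (x + Pi.single (0 : Fin 4) (n : ℤ))) a) ^ 2) -
                lam / 2 * D * curvaturePlaquetteCorr (d := 4) (by norm_num) 0)
            ∂curvatureGaussianField (d := 4) D) ^ 2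
      ∂curvatureGaussianField (d := 4) D ≤ M₂ * B.card := by
  obtain ⟨M₂, hM0, hM⟩ := gauss_secondCumulant_le D lam
  refine ⟨M₂, hM0, fun n B => ?_⟩
  rw [gauss_firstCumulant_sum D lam n B]
  exact hM n B

end Susceptibility

end Summit.QuantumFields.YangMills.Cruxes.SourcedPressureIncrement.Birth
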